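import Summits.BirchSwinnertonDyer.BirchSwinnertonDyer.Theses.SchneiderFreeAdditiveX3
import Summits.BirchSwinnertonDyer.BirchSwinnertonDyer.Theorems.SchneiderFreeAdditiveX3ControlNoLocalPTorsionF
import Summits.BirchSwinnertonDyer.BirchSwinnertonDyer.Theorems.SchneiderFreeAdditiveX3ControlNoGlobalPTorsionF
import HarnessLib

/-!
# Crux `AnticycControlAdditiveKF` (route `SchneiderFreeAdditiveX3`, item stmt-BirchSwinnertonDyer-19548) —
# the v4-KF composition with the two landed regime items, MODULO Fin_v (item 19546) and regime B2 (item 19547)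

Seat `bsd-schneider-door-c4`, gen 3 (cell `bsd-schneider-ideate`). The served control crux of the K1 door
(board row B6 ∩ X3 ∩ sst-twist, `r = 1`) is, by the route base unit's skeleton v4-KF (`3dbdb197…`,
kernel-checked composition `AnticycControlAdditiveKF_of`), the local/global `p`-torsion TRICHOTOMY of the
frames: regime A (`E(K̄)[p^∞]^{D_𝔭}[p] = 0`) = item `ControlNoLocalPTorsionF` (CLOSED, p437517,
`stub_regimeA`), regime B1 (`E(K)[p] = 0`, given Fin_v) = item `ControlNoGlobalPTorsionF` (CLOSED, p437649,
`stub_regimeB1`), Fin_v on the cells = item `LocalTowerTorsionFiniteX3` (crux r5, seat door-c5), regime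
B2 (`E(K)[p] ≠ 0`, given Fin_v) = item `ControlGlobalPTorsionF` (crux r6). This file lands the composition
with the two CLOSED regimes supplied BY NAME, so that the crux follows from the two remaining items the hour
they land:

* **`anticycControlAdditiveKF_of_finV_of_regimeB2 : LocalTowerTorsionFiniteX3 → ControlGlobalPTorsionF →
  AnticycControlAdditiveKF`** (the skeleton's `AnticycControlAdditiveKF_of` with `stub_regimeA`,
  `stub_regimeB1` plugged in);
* `anticycControlAdditiveK_of_controlFacts_of_KF : ControlFacts → AnticycControlAdditiveKF → AnticycControlAdditiveK`
  (the superseded Kolyvagin-only item stmt-BirchSwinnertonDyer-19295 from the facts binder).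

CONDITIONAL (the two open items are hypotheses BY NAME; the cited facts are antecedents of the statements);
closes nothing by itself; BSD is not proved by any of this.

References: [JetchevSkinnerWan2017] Thm. 3.3.1 (arXiv:1512.06894 p. 11); [Castella2018] Thm. 2.3;
[MilneADT2006] I 4.10, 2.8; [Brink2007] Thm. 2, Cor. 1.
-/

set_option linter.dupNamespace false

namespace Summit.BirchSwinnertonDyer.BirchSwinnertonDyer.Theorems.SchneiderFreeAdditiveX3

open Summit.BirchSwinnertonDyer.BirchSwinnertonDyer.Theses.SchneiderFreeAdditiveX3

/-- **The served crux `AnticycControlAdditiveKF` from Fin_v (item `LocalTowerTorsionFiniteX3`) and regime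
B2 (item `ControlGlobalPTorsionF`)**, the regimes A and B1 being the CLOSED items `ControlNoLocalPTorsionF`
(`stub_regimeA`) and `ControlNoGlobalPTorsionF` (`stub_regimeB1`): the v4-KF trichotomy — at a frame,
either `E(K̄)[p^∞]^{D_𝔭}` has no `p`-torsion (regime A), or Fin_v holds on the cell and then either
`E(K)[p] = 0` (regime B1) or not (regime B2). [cite: JetchevSkinnerWan2017, Thm. 3.3.1 (arXiv:1512.06894 p. 11)] -/
theorem anticycControlAdditiveKF_of_finV_of_regimeB2 (hFin : LocalTowerTorsionFiniteX3)
    (hB2 : ControlGlobalPTorsionF) : AnticycControlAdditiveKF := by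
  intro hPT hSha hBr hBrA hKo W _ _ p _ hr hp2 hX hS N _ K _ _ Dt H ι P hr' hloc hN hKiq hodd hunit hHe hL
    hP hnt κ hκ γ _ 𝔭 h𝔭 he hf
  by_cases h0 : ∀ m : (W.baseChange K).geomPrimaryTorsion p,
      (∀ d ∈ Literature.NumberTheory.EllipticCurves.GreenbergSelmer.decomp 𝔭, d • m = m) → p • m = 0 → m = 0
  · exact stub_regimeA hPT hSha hBr hKo W p hr hp2 hX hS N K Dt H ι P hr' hloc hN hKiq hodd hunit hHe hL hP
      hnt κ hκ γ 𝔭 h𝔭 he hf h0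
  · have hfin := hFin W p hr hp2 hX hS
    by_cases hg : ∀ x : (W.baseChange K).toAffine.Point, p • x = 0 → x = 0
    · exact stub_regimeB1 hPT hSha hBr hBrA hKo W p hr hp2 hX hS hfin N K Dt H ι P hr' hloc hN hKiq hodd
        hunit hHe hL hP hnt κ hκ γ 𝔭 h𝔭 he hf hg
    · exact hB2 hPT hSha hBr hBrA hKo W p hr hp2 hX hS hfin N K Dt H ι P hr' hloc hN hKiq hodd hunit hHe
        hL hP hnt κ hκ γ 𝔭 h𝔭 he hf hg

/-- The superseded Kolyvagin-only item `AnticycControlAdditiveK` (stmt-BirchSwinnertonDyer-19295) from the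
facts binder `ControlFacts` (stmt-BirchSwinnertonDyer-19538) and the served crux. [folklore] -/
theorem anticycControlAdditiveK_of_controlFacts_of_KF (hCF : ControlFacts) (h : AnticycControlAdditiveKF) :
    AnticycControlAdditiveK := by
  obtain ⟨hPT, hSha, hBr, hBrA⟩ := hCF
  exact h hPT hSha hBr hBrA

/-- Hence the superseded item from the facts binder, Fin_v and regime B2. [folklore] -/
theorem anticycControlAdditiveK_of_controlFacts_of_finV_of_regimeB2 (hCF : ControlFacts)
    (hFin : LocalTowerTorsionFiniteX3) (hB2 : ControlGlobalPTorsionF) : AnticycControlAdditiveK :=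
  anticycControlAdditiveK_of_controlFacts_of_KF hCF (anticycControlAdditiveKF_of_finV_of_regimeB2 hFin hB2)

end Summit.BirchSwinnertonDyer.BirchSwinnertonDyer.Theorems.SchneiderFreeAdditiveX3
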